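import Literature.AlgebraicGeometry.Frobenioids.Cor411AsPrinted
import Literature.AlgebraicGeometry.Frobenioids.Prop55Sub
import HarnessLib

/-!
# Frobenioids I, Corollary 4.11 (iii) AS TYPED (`PreFrobenioidData.Cor411iii`), in print's generality,
# AT THE CONSTRUCTIONS — no residual binder, no hypothesis on the base categories (FACT-LIST row F-1027)

Mochizuki, *The geometry of Frobenioids I: the general theory*, Kyushu J. Math. **62** (2008)
293–400, kurims text: Cor. 4.11 (iii) p. 92 "Suppose further that `C₁`, `C₂` are of rationally standard
type. Then there exists an isomorphism of functors `Ψ^Φ : Φ₁ ⥲ Φ₂` … lying over the equivalence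
`Ψ^Base : D₁ ⥲ D₂` of (ii)"; proof p. 94 "assertion (iii) follows formally from assertion (ii); Theorem 4.9"
[cite: MochizukiFrdI2008, Cor. 4.11 (iii) p.92].

PROOF-ONLY companion of `DivisorMonoidCategoryTheoreticity.lean` (cell abc-iut, F fact-proving wave, seat
abc-iut-f-032; FACT-LIST row **F-1027** `PreFrobenioidData.Cor411iii`, [FrdI] Corollary 4.11 (iii) p. 92),
sequel of `DivisorMonoidCategoryTheoreticityCor411iiiHolds.lean` (same seat: the FSM-type route). The row is
a schema over the data-only interfaces (universal closure refuted: `PreFrobenioidData.not_forall_cor411iii`);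
what print asserts is the instance at THE Frobenioids and THE Def. 4.5 (iii) parameters. Seat abc-iut-L1-d6's
`FrdI.cor411iii_ofFunctor` (`Cor411AsPrinted.lean`: Thm. 3.4 (ii) as printed `FrdI.thm34ii_ofFunctor` of seats
abc-iut-L1-t11/t13 → Cor. 4.11 (ii) `cor411ii_ofFunctor_of_thm34ii` → Thm. 4.9 / descent `D^* ⥲ D`) proves the
typed Cor. 4.11 (iii) for EVERY pair of Frobenioids with perf-factorial `Φ_i`, EVERY `Ψ` and ARBITRARY
parameters `R_i`, with NO hypothesis on `D_i` beyond the typed antecedent (standard type (d): FSMFF), modulo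
the single input `hrat₁` — "`C₁` of rational type" read at THE birationalization / THE support predicate.
Here, assembled BY NAME and nothing re-proved:

* `PreFrobenioid.cor411iii_rsParams_asPrinted` — with `C₁`'s Def. 4.5 (iii) parameters THE constructions
  `rsParams hF₁ PrimarySupp` (seat abc-iut-L1-d1's `PreFrobenioid.rsParams`: THE birationalization of
  Prop. 4.4, THE unit-trivialisation of Prop. 3.3 (iv), THE support predicate of Def. 2.4 (i)(d)) and `R₂`
  arbitrary, `hrat₁` IS the `rational` field of the typed antecedent `IsOfRationallyStandardType`, so the
  typed Cor. 4.11 (iii) holds with NO residual binder and NO base hypothesis;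
* `PreFrobenioid.cor411iii_holds_asPrinted` — both `R_i` THE constructions (the instance form of F-1027 the
  cone consumes, in print's generality);
* `PreFrobenioid.exists_baseSquare_divisorMonoidIsoOverBase_asPrinted` — unpacked: `Ψ^Base` and `Ψ^Φ`.

Hypotheses: Frobenioids (`IsFrobenioid`) with perf-factorial `Φ_i` (§4 standing hypothesis, Def. 2.4 (i)) —
exactly print's. No definitions; no statement of the paper is restated or strengthened; nothing here is
specific to the abc programme and no side is taken on [IUTchIII] Cor. 3.12.
-/

namespace Literature.AlgebraicGeometry.Frobenioids

open CategoryTheory Opposite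

universe w v v' u u'

namespace PreFrobenioid

variable {D₁ : Type u} [Category.{v} D₁] {Φ₁ : D₁ᵒᵖ ⥤ CommMonCat.{w}} {C₁ : Type u'} [Category.{v'} C₁]
  {D₂ : Type u} [Category.{v} D₂] {Φ₂ : D₂ᵒᵖ ⥤ CommMonCat.{w}} {C₂ : Type u'} [Category.{v'} C₂]
  {F₁ : C₁ ⥤ ElemFrobenioid Φ₁} {F₂ : C₂ ⥤ ElemFrobenioid Φ₂}

/-- **[FrdI] Cor. 4.11 (iii) AS TYPED, in print's generality, `C₁`'s Def. 4.5 (iii) parameters THE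
constructions, `R₂` arbitrary — no residual binder, no base hypothesis**: for EVERY pair of Frobenioids
`C_i → F_{Φ_i}` with perf-factorial `Φ_i` and EVERY equivalence `Ψ : C₁ ⥲ C₂`, under the typed antecedents
(`Cor411Setting`; "`C_i` of rationally standard type", for `C₁` at `rsParams hF₁ PrimarySupp`) there is a
`1`-unique `Ψ^Base : D₁ ⥲ D₂` over the base functors and an isomorphism of functors `Ψ^Φ : Φ₁ ⥲ Φ₂` lying over
it. Seat abc-iut-L1-d6's `FrdI.cor411iii_ofFunctor` with its `hrat₁` supplied by the `rational` field of the
antecedent. [cite: MochizukiFrdI2008, Cor. 4.11 (iii) p.92] -/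
theorem cor411iii_rsParams_asPrinted (hF₁ : IsFrobenioid F₁) (hF₂ : IsFrobenioid F₂)
    (hpf₁ : Objectwise (fun M _ => IsPerfFactorial M) Φ₁) (hpf₂ : Objectwise (fun M _ => IsPerfFactorial M) Φ₂)
    (Ψ : C₁ ≌ C₂) (R₂ : (PreFrobenioidData.ofFunctor Φ₂ F₂).RSParams) :
    (PreFrobenioidData.ofFunctor Φ₁ F₁).Cor411iii (PreFrobenioidData.ofFunctor Φ₂ F₂) Ψ
      (rsParams hF₁ fun a 𝔭 => PrimarySupp a 𝔭) R₂ :=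
  fun hs hR₁ hR₂ =>
    FrdI.cor411iii_ofFunctor hF₁ hF₂ hpf₁ hpf₂ (fun A => hR₁.rational A) Ψ _ R₂ hs hR₁ hR₂

/-- **[FrdI] Cor. 4.11 (iii) AS TYPED, in print's generality, AT THE CONSTRUCTIONS — the instance form of
FACT-LIST row F-1027 with no residual binder and no base hypothesis**: both Def. 4.5 (iii) parameter packages
are THE constructions `rsParams hF_i PrimarySupp`. [cite: MochizukiFrdI2008, Cor. 4.11 (iii) p.92] -/
theorem cor411iii_holds_asPrinted (hF₁ : IsFrobenioid F₁) (hF₂ : IsFrobenioid F₂)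
    (hpf₁ : Objectwise (fun M _ => IsPerfFactorial M) Φ₁) (hpf₂ : Objectwise (fun M _ => IsPerfFactorial M) Φ₂)
    (Ψ : C₁ ≌ C₂) :
    (PreFrobenioidData.ofFunctor Φ₁ F₁).Cor411iii (PreFrobenioidData.ofFunctor Φ₂ F₂) Ψ
      (rsParams hF₁ fun a 𝔭 => PrimarySupp a 𝔭) (rsParams hF₂ fun a 𝔭 => PrimarySupp a 𝔭) :=
  cor411iii_rsParams_asPrinted hF₁ hF₂ hpf₁ hpf₂ Ψ _

/-- **Unpacked form** of `cor411iii_holds_asPrinted` ("in particular, `Ψ^Base`, `Ψ^Φ` induce an equivalence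
`Ψ^F : F_{Φ₁} ⥲ F_{Φ₂}`", p. 92): for every pair of Frobenioids with perf-factorial `Φ_i` and every `Ψ`, under
`Cor411Setting` and "`C_i` of rationally standard type" at THE constructions, `Ψ` induces a `1`-unique base
equivalence `Ψ^Base` and an isomorphism of functors `Ψ^Φ : Φ₁ ⥲ Φ₂` over it — no base hypothesis.
[cite: MochizukiFrdI2008, Cor. 4.11 (iii) p.92] -/
theorem exists_baseSquare_divisorMonoidIsoOverBase_asPrinted (hF₁ : IsFrobenioid F₁) (hF₂ : IsFrobenioid F₂)
    (hpf₁ : Objectwise (fun M _ => IsPerfFactorial M) Φ₁) (hpf₂ : Objectwise (fun M _ => IsPerfFactorial M) Φ₂)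
    (Ψ : C₁ ≌ C₂)
    (hs : (PreFrobenioidData.ofFunctor Φ₁ F₁).Cor411Setting (PreFrobenioidData.ofFunctor Φ₂ F₂) Ψ)
    (hR₁ : (PreFrobenioidData.ofFunctor Φ₁ F₁).IsOfRationallyStandardType
      (rsParams hF₁ fun a 𝔭 => PrimarySupp a 𝔭))
    (hR₂ : (PreFrobenioidData.ofFunctor Φ₂ F₂).IsOfRationallyStandardType
      (rsParams hF₂ fun a 𝔭 => PrimarySupp a 𝔭)) :
    ∃ ΨBase : D₁ ⥤ D₂,
      PreFrobenioidData.OneUniqueSquare Ψ.functor (PreFrobenioidData.ofFunctor Φ₁ F₁).base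
          (PreFrobenioidData.ofFunctor Φ₂ F₂).base ΨBase ∧
        Nonempty ((PreFrobenioidData.ofFunctor Φ₁ F₁).DivisorMonoidIsoOverBase
          (PreFrobenioidData.ofFunctor Φ₂ F₂) ΨBase) :=
  cor411iii_holds_asPrinted hF₁ hF₂ hpf₁ hpf₂ Ψ hs hR₁ hR₂

end PreFrobenioid

end Literature.AlgebraicGeometry.Frobenioids
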